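import Literature.AnabelianGeometry.EtaleTheta.Discharge.Sec4NonVacuityCoveringRoots
import Literature.AnabelianGeometry.EtaleTheta.Discharge.Sec4Remark411
import Literature.AlgebraicGeometry.Frobenioids.ModelFrobenioidBaseSection
import HarnessLib

/-!
# [EtTh] Remark 4.1.1 FAILS at the Kummer-tower toy: genuine degree-`2` data of base-Frobenius type exist,
# but `Aut_D(∗) = 1` cannot see the cover (consistency witness — negative instance)

S. Mochizuki, *The étale theta function and its Frobenioid-theoretic manifestations*, Publ. RIMS **45**
(2009) [MochizukiEtTh2009], §4, Def 4.1 (iv) p.87 (base-Frobenius type), Remark 4.1.1 p.88 ("`A → B` is a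
categorical quotient … by `G · μ_N(A)`"); [FrdI] Def 2.7 (iii) (base-Frobenius pairs), Thm 5.2 proof p.101.

CONSISTENCY WITNESS, TOY.  PROOF-ONLY.  Twin of `Sec4NonVacuityRemark411.lean` (`Toy.remark411`: at the cover-free
toy the typed Rmk 4.1.1 HOLDS, degenerately) and an instance, through `mkOfModelCanonical`, of abc-iut-f-108's
schema refutation (F-0729, span base): at `ToyCov.biKummerSetting` (p427822) —
* `ToyCov.exists_baseFrobeniusTypeData_two`, `ToyCov.isOfBaseFrobeniusType_two` — GENUINE data "of base-Frobenius type" of Frobenius degree `2` for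
  `α := α'' ≫ α' : A_⊙ → A_⊙` with `α'' = (2, id, 0, 1)` the Frobenius endomorphism and `α' = (1, t ↦ t², 0, 1)` the
  pull-back morphism over the degree-`2` Kummer cover: (a) `A_⊙` Frobenius-trivial, Galois, `μ_2`-SATURATED (REAL,
  `ToyCov.isMuSaturated`); (b) `G = 1 ⥲ Gal(A_⊙^bs/A_⊙^bs) = Aut_D(∗) = 1`; (c), (d); (e) `G, α', α''` ARISE FROM THE
  BASE-FROBENIUS PAIR given by L1's zero sections (`ModelFrobenioid.isBaseFrobeniusPair_zero`, REAL [FrdI] Def 2.7 (iii));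
* `ToyCov.not_remark411 : ¬ ToyCov.biKummerSetting.Remark411` — the Frobenius endomorphism `ψ = (2, id, 0, 1)` of
  the Frobenius-trivial `A_⊙` is invariant under `G · μ_2(A_⊙)` (abc-iut-w4-d044's `hom_comp_eq_of_mem_mu`) but does
  NOT factor through `α` (its base degree `1` is not divisible by `2`).
DIAGNOSIS (same as f-108's): the typed Def 4.1 (iv)(b) computes `Gal(A^bs/B^bs)` inside `D`; over a base whose
automorphism groups are too small (here `Aut_D(∗) = 1` while the cover has degree `2`) the data exist without the
quotient property — Rmk 4.1.1 uses that `D = B^temp(Π)⁰` is a Galois category (covers are quotients by deck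
groups), an input not recorded in `BiKummerSetting`.  With `Toy.remark411`: the typed Rmk 4.1.1 is independent of the
setting axioms + the whole typed §4 statement set (all of which hold at ToyCov, p429194).  Consistency ≠ faithfulness;
typed ≠ proved.  Nothing here bears on, or takes a side on, [IUTchIII] Cor. 3.12.
-/

noncomputable section

namespace Literature.AnabelianGeometry.EtaleTheta

open CategoryTheory Opposite Literature.AlgebraicGeometry.Frobenioids
open scoped NNRat

namespace ToyCov

/-- The one-object base is skeletal. [cite: MochizukiEtTh2009, Def 3.6 p.76] -/
theorem skeletal_base : Skeletal Base := fun X Y _ => Subsingleton.elim X Y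

/-- The relation of the model Frobenioid for `(1, cover N, 0, 1)` at `A_⊙`. [cite: MochizukiFrdI2008, Thm. 5.2(i) p.100] -/
private theorem cover_rel' (N : ℕ+) :
    Aodot.cls ^ ((1 : ℕ+) : ℕ) * Algebra.GrothendieckGroup.of (1 : temperedFrobenioid.divisorMonoid.obj (op Aodot.base)) =
      pullGp temperedFrobenioid.divisorMonoid (cover Aodot.base Aodot.base N) Aodot.cls *
        divB temperedFrobenioid.divisorMonoid temperedFrobenioid.ratFnFunctor temperedFrobenioid.divBNatTrans
          (op Aodot.base) 1 := by
  simp only [PNat.one_coe, pow_one, map_one, mul_one]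
  exact (map_one _).symm

/-- **Genuine data of base-Frobenius type of degree `2` EXIST at the Kummer-tower toy** (with `G = 1`):
`α'' = (2, id, 0, 1)` (L1's `zeroFrob`), `α' = (1, t ↦ t², 0, 1)`; (a) REAL `μ_2`-saturation, (e) REAL [FrdI]
Def 2.7 (iii) via the zero base-Frobenius pair (`isBaseFrobeniusPair_zero`). [cite: MochizukiEtTh2009, Def 4.1 p.87] -/
theorem exists_baseFrobeniusTypeData_two :
    ∃ d : biKummerSetting.BaseFrobeniusTypeData
      (ModelFrobenioid.zeroFrob Aodot rfl 2 ≫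
        ModelFrobenioid.mkHom Aodot Aodot 1 (cover Aodot.base Aodot.base 2) 1 1 (cover_rel' 2)), d.G = ⊥ :=
  ⟨{ G := ⊥
     G_le := bot_le
     α₂ := ModelFrobenioid.zeroFrob Aodot rfl 2
     α₁ := ModelFrobenioid.mkHom Aodot Aodot 1 (cover Aodot.base Aodot.base 2) 1 1 (cover_rel' 2)
     fac := rfl
     isFrobeniusTrivial := isFrobeniusTrivial_Aodot
     isGalois := trivial
     isMuSaturated := isMuSaturated Aodot _
     mapsIsomorphically := by
       refine ⟨fun σ hσ => ?_, fun σ hσ τ hτ _ => ?_, fun τ _ => ⟨1, (⊥ : Subgroup (Aut Aodot)).one_mem, ?_⟩⟩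
       · have hσ' : σ = 1 := hσ
         subst hσ'
         rw [map_one]
         exact one_mem _
       · exact (show σ = 1 from ‹σ ∈ ((⊥ : Subgroup (Aut Aodot)) : Set (Aut Aodot))›).trans
           (show τ = 1 from ‹τ ∈ ((⊥ : Subgroup (Aut Aodot)) : Set (Aut Aodot))›).symm
       · rw [map_one]
         exact (aut_eq_one _ τ).symm
     cond_c := ⟨rfl, ⟨ModelFrobenioid.isCoAngular ratFnFunctor_isGroupLike _, rfl⟩,
       show IsIso (𝟙 (ModelFrobenioid.base Aodot)) from inferInstance⟩
     cond_d := ModelFrobenioid.isPullbackMorphism_of divisorMonoid_isDivisorial ratFnFunctor_isGroupLike rfl rfl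
     cond_e := by
       refine ⟨ModelFrobenioid.zeroPresection _ _ _, ModelFrobenioid.zeroFrobeniusSection _ _ _,
         ModelFrobenioid.isBaseFrobeniusPair_zero divisorMonoid_isDivisorial ratFnFunctor_isGroupLike skeletal_base,
         fun γ hγ => ?_, ⟨rfl, rfl, rfl, rfl, rfl⟩, ⟨rfl, 2, rfl⟩⟩
       have hγ' : γ = 1 := hγ
       subst hγ'
       exact ⟨rfl, rfl, rfl, rfl, rfl⟩ }, rfl⟩

/-- Hence `α = (2, t ↦ t², 0, 1) : A_⊙ → A_⊙` IS of base-Frobenius type at the Kummer-tower toy (Def 4.1 (iv)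
inhabited at Frobenius degree `2`). [cite: MochizukiEtTh2009, Def 4.1 p.87] -/
theorem isOfBaseFrobeniusType_two :
    biKummerSetting.IsOfBaseFrobeniusType
      (ModelFrobenioid.zeroFrob Aodot rfl 2 ≫
        ModelFrobenioid.mkHom Aodot Aodot 1 (cover Aodot.base Aodot.base 2) 1 1 (cover_rel' 2)) :=
  let ⟨d, _⟩ := exists_baseFrobeniusTypeData_two
  ⟨d⟩

/-- **[EtTh] Remark 4.1.1 FAILS at the Kummer-tower toy** (typed `BiKummerSetting.Remark411`): for the degree-`2`
data above, the `G · μ_2(A_⊙)`-invariant Frobenius endomorphism `ψ = (2, id, 0, 1) : A_⊙ → A_⊙` of the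
Frobenius-trivial `A_⊙` does not factor through `α = (2, t ↦ t², 0, 1)` — base degrees: `2 ∤ 1`.
[cite: MochizukiEtTh2009, Rmk 4.1.1 p.88] -/
theorem not_remark411 : ¬ biKummerSetting.Remark411 := by
  intro h
  obtain ⟨d, hG⟩ := exists_baseFrobeniusTypeData_two
  obtain ⟨-, hq⟩ := h _ d
  -- the test morphism `ψ = (2, id, 0, 1)` is invariant under `G ⊔ ⟨μ_2(A_⊙)⟩`
  have hinv : ∀ γ ∈ d.G ⊔
      Subgroup.closure (biKummerSetting.mu Aodot (biKummerSetting.degFr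
        (ModelFrobenioid.zeroFrob Aodot rfl 2 ≫
          ModelFrobenioid.mkHom Aodot Aodot 1 (cover Aodot.base Aodot.base 2) 1 1 (cover_rel' 2)))),
      γ.hom ≫ ModelFrobenioid.zeroFrob Aodot rfl 2 = ModelFrobenioid.zeroFrob Aodot rfl 2 := by
    have hle : d.G ⊔
        Subgroup.closure (biKummerSetting.mu Aodot (biKummerSetting.degFr
          (ModelFrobenioid.zeroFrob Aodot rfl 2 ≫
            ModelFrobenioid.mkHom Aodot Aodot 1 (cover Aodot.base Aodot.base 2) 1 1 (cover_rel' 2)))) ≤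
        biKummerSetting.autOver (ModelFrobenioid.zeroFrob Aodot rfl 2) :=
      sup_le (fun γ hγ => by
          rw [hG] at hγ
          have hγ' : γ = 1 := hγ
          subst hγ'
          exact (biKummerSetting.autOver _).one_mem)
        ((Subgroup.closure_le _).mpr fun σ hσ =>
          biKummerSetting.hom_comp_eq_of_mem_mu divisorMonoid_isDivisorial _ hσ)
    exact fun γ hγ => hle hγ
  obtain ⟨ψ', hψ', -⟩ := hq isFrobeniusTrivial_Aodot _ hinv
  -- compare base degrees: `deg (cover 2 ≫ Base ψ') = 1` is impossible
  have hb := congrArg (fun φ => (deg (ModelFrobenioid.baseMap φ) : ℕ)) hψ'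
  change ((deg (ModelFrobenioid.baseMap ψ') * (2 * 1) : ℕ+) : ℕ) = ((1 : ℕ+) : ℕ) at hb
  have h2 : ((2 : ℕ+) : ℕ) = 2 := rfl
  rw [PNat.mul_coe, PNat.mul_coe, PNat.one_coe, h2] at hb
  omega

end ToyCov

end Literature.AnabelianGeometry.EtaleTheta

end
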